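import Summits.RiemannHypothesis.RiemannHypothesis.Theorems.HandoffLossyCoupling
import HarnessLib

/-!
# The ATTAINED CASE of the open criterion, typed as an RH-free analytic target, and its reduction

Cell `rh-explicit`, TRACK «HANDOFF», seat handoff-theory-1 (definitions + logic), gen3.  Companion text:
`HOME/handoff/HANDOFF-STATEMENT.md` §J.4 and `HOME/handoff/theory-1/BOTTOM-DROP-SKETCH.md` (paper sketch, ARGUED).
Builds on `HandoffLossyCoupling.lean` (this seat: `WeilBottomBoundedCriterion`).

HONEST FRAMING.  Nothing here is a step towards RH, and nothing here is a theorem ABOUT the zeros of ζ.  `WeilBottomBoundedCriterion`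
(«a uniform lower bound on the window bottom `ε(t) = weilGroundEnergy t` implies RH») is OPEN.  Its main case has a concrete, RH-FREE analytic
content, which this file TYPES so that a prover seat can attack it against Mathlib's `riemannZeta`:

* `offLineZetaZeros` — the zeros of `riemannZeta` that Mathlib's `RiemannHypothesis` is about (not `−2(n+1)`, not `1`) and that lie OFF the
  line `Re = ½`; `riemannHypothesis_iff_offLineZetaZeros_eq_empty` (bookkeeping).
* `WeilBottomDropOfExtremalZero` — TARGET (OPEN, ARGUED on paper): if `ρ₀` is an off-line zero whose distance `|Re ρ₀ − ½|` from the critical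
  line is MAXIMAL among off-line zeros, then the window bottom is unbounded below (`∀ C, ∃ t > 0, ε(t) < −C`).  The sketch: test the explicit
  formula with the modulated, dilated antisymmetric two-layer pair `λ^{−1/2}(φ₊ − φ₋)(x/λ)e^{−iγ₀x}`; the term of `ρ₀` is `−λΨ(λδ₀)² ≤
  −λ(e^{λδ₀(T−1)} − 1)²` with no phase, every other zero is smaller (zero counting + one Laplace lemma for the flat bump).
* `weilBottomBoundedCriterion_of_drop_of_finite` — PROVED reduction: the target together with «only finitely many zeros lie off the line» gives
  `WeilBottomBoundedCriterion` (a finite non-empty set of off-line zeros has an element of maximal distance; pure bookkeeping, no analysis).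
  So in the «finitely many off-line zeros» world the whole lossy tier of §J (fixed-loss coupling laws, summable-loss increments) is RH-strength
  as soon as the target is proved.

References: this track HANDOFF-STATEMENT §J.4, BOTTOM-DROP-SKETCH.md; Bombieri 2000 §1 (the trichotomy keeping «infinitely many off-line zeros»
as the un-excluded case of a related problem) [Bombieri2000Weil].
-/

set_option linter.dupNamespace false  -- the mandated namespace repeats `RiemannHypothesis`

noncomputable section

open Set Literature.NumberTheory.LFunctions

namespace Summit.RiemannHypothesis.RiemannHypothesis.Theorems.HandoffDecomposition

/-- The OFF-LINE zeros of `riemannZeta` in the sense of Mathlib's `RiemannHypothesis`: zeros other than the listed trivial ones `−2(n+1)` and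
other than the junk point `1`, whose real part is not `½`.  (`RiemannHypothesis` says exactly that this set is empty.) [folklore] -/
def offLineZetaZeros : Set ℂ :=
  {ρ : ℂ | riemannZeta ρ = 0 ∧ (¬ ∃ n : ℕ, ρ = -2 * (n + 1)) ∧ ρ ≠ 1 ∧ ρ.re ≠ 1 / 2}

/-- `RH ↔` there are no off-line zeros (Mathlib's statement, re-packaged). [folklore] -/
theorem riemannHypothesis_iff_offLineZetaZeros_eq_empty :
    Summit.RiemannHypothesis ↔ offLineZetaZeros = ∅ := by
  rw [Set.eq_empty_iff_forall_notMem]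
  constructor
  · intro h ρ hρ
    exact hρ.2.2.2 (h ρ hρ.1 hρ.2.1 hρ.2.2.1)
  · intro h s hs hnt hs1
    by_contra hre
    exact h s ⟨hs, hnt, hs1, hre⟩

/-- **TARGET (OPEN; ARGUED on paper in BOTTOM-DROP-SKETCH.md): the window bottom drops without bound from an EXTREMAL off-line zero.**  If
`ρ₀` is an off-line zero of `ζ` whose distance from the critical line is maximal among all off-line zeros, then for every `C` some window
`t > 0` has `ε(t) < −C`.  An RH-FREE analytic statement (it speaks about what an off-line zero DOES, not about whether one exists); under RH it
holds vacuously.  A statement of THIS track, not a literature fact. [this track (theory-1 gen3), BOTTOM-DROP-SKETCH.md — OPEN] -/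
def WeilBottomDropOfExtremalZero : Prop :=
  ∀ ρ₀ ∈ offLineZetaZeros, (∀ ρ ∈ offLineZetaZeros, |ρ.re - 1 / 2| ≤ |ρ₀.re - 1 / 2|) →
    ∀ C : ℝ, ∃ t : ℝ, 0 < t ∧ weilGroundEnergy t < -C

/-- Under RH the target is vacuous (no off-line zeros) — recorded only to make the logical shape explicit: all of its content lives in the
`¬RH` world. [this track (theory-1 gen3)] -/
theorem weilBottomDropOfExtremalZero_of_riemannHypothesis (hRH : Summit.RiemannHypothesis) :
    WeilBottomDropOfExtremalZero := by
  intro ρ₀ hρ₀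
  rw [riemannHypothesis_iff_offLineZetaZeros_eq_empty.1 hRH] at hρ₀
  exact absurd hρ₀ (Set.notMem_empty ρ₀)

/-- **REDUCTION (proved): target + finitely many off-line zeros ⟹ `WeilBottomBoundedCriterion`.**  If RH failed, the finite non-empty set of
off-line zeros would have an element of maximal distance from the line; the target then makes the bottom unbounded below, contradicting the
assumed uniform lower bound. [this track (theory-1 gen3)] -/
theorem weilBottomBoundedCriterion_of_drop_of_finite (h : WeilBottomDropOfExtremalZero) (hfin : offLineZetaZeros.Finite) :
    WeilBottomBoundedCriterion := by
  rintro ⟨C, hC⟩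
  by_contra hRH
  have hne : ∃ s, s ∈ offLineZetaZeros := by
    by_contra hnone
    push Not at hnone
    exact hRH (riemannHypothesis_iff_offLineZetaZeros_eq_empty.2 (Set.eq_empty_iff_forall_notMem.2 hnone))
  obtain ⟨s, hs⟩ := hne
  obtain ⟨ρ₀, hρ₀, hmax⟩ :=
    hfin.toFinset.exists_max_image (fun ρ : ℂ ↦ |ρ.re - 1 / 2|) ⟨s, hfin.mem_toFinset.2 hs⟩
  obtain ⟨t, ht, hlt⟩ := h ρ₀ (hfin.mem_toFinset.1 hρ₀) (fun ρ hρ ↦ hmax ρ (hfin.mem_toFinset.2 hρ)) C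
  linarith [hC t ht]

/-- The same reduction phrased as an equivalence with RH in the finite-off-line world: granted the target and finiteness,
`RH ↔ (∃ C, ∀ t > 0, −C ≤ ε(t))`. [this track (theory-1 gen3)] -/
theorem riemannHypothesis_iff_bddBelow_of_drop_of_finite (h : WeilBottomDropOfExtremalZero) (hfin : offLineZetaZeros.Finite) :
    Summit.RiemannHypothesis ↔ ∃ C : ℝ, ∀ t : ℝ, 0 < t → -C ≤ weilGroundEnergy t :=
  weilBottomBoundedCriterion_iff.1 (weilBottomBoundedCriterion_of_drop_of_finite h hfin)

end Summit.RiemannHypothesis.RiemannHypothesis.Theorems.HandoffDecomposition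

end
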